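import Mathlib
import Summits.Parity.GeneralizedHardyLittlewood.Theses.LiouvilleShiftedTables
import Summits.Parity.GeneralizedHardyLittlewood.Theorems.TableChowla.Negative.TableChowlaExceptionalSet

/-!
# Line `helson-kronecker-inverse` — checked skeleton for crux `TableChowla` (stmt-Parity-14270)

Crux (route `LiouvilleShiftedTables`, decl
`Summit.Parity.GeneralizedHardyLittlewood.Theses.LiouvilleShiftedTables.TableChowla`): for every shift
`c ≠ 0`, every `0 < δ ≤ 1/12`, every `C > 0` and all large `x`, uniformly for `x^δ ≤ A ≤ x^{1/3+δ}`, the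
fourth moment `T = tr (M_c M_cᵀ)² = ∑_{a,a'} (∑_b λ(ab+c)λ(a'b+c))²` of the shifted multiplication table
`M_c = (λ(ab+c))_{a ∈ (⌊A⌋,⌊2A⌋], b ∈ [1,⌊x/A⌋]}` is `≤ x²/(log x)^C`.

Idea card `Ideas/helson-kronecker-inverse.md` (ideator 2; triage r1-1/2/3: pass ×3). This crux-plan
renders it in the ONE-SIDED (column) form and PROVES everything except three registered stubs, so that
the stub set is an EXACT splitting of the crux (`tableChowla_iff_stubs`, sorry-free):

  `TableChowla ↔ (InverseCM ∧ MeanSquareCMPeriodic ∧ MeanSquareCMAperiodic)`.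

* PROVED the card's transfer stub `OperatorNormForm → TableChowla` ("provable now"; here
  `tableChowlaFor_of_operatorNormForm` on the landed read-back form `Negative.TableChowlaFor lam`, and
  `operatorNormForm_iff_tableChowla`): `T = ∑_a ‖M (Mᵀe_a)‖² ≤ ‖M‖_op²·‖M‖_F² ≤ (x/(log x)^{2C+2})·2x`
  (`moment_le_of_opNorm`, finite linear algebra). Also PROVED the converse
  `operatorNormForm_of_tableChowla` (`|uᵀMv| ≤ ‖Mv‖ ≤ T^{1/4}`), so `C⁺ = OperatorNormForm ↔ crux`.
* STUB `stub_inverse : InverseCM` — THE LEVER (inverse theorem for finite Helson sections of the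
  symbol `m ↦ λ(m+c)`, one-sided, quantifiers `∀ C ∃ C'` as triage r1-1/r1-2 required): if some pair of
  `ℓ²`-unit test vectors `u, v` has `|uᵀ M_c v| ≥ √x/(log x)^C`, then some completely multiplicative
  1-bounded `g : ℕ → ℂ` and some initial segment `b ≤ y ≤ x/A` have
  `∑_{a} |∑_{b ≤ y} g(b) λ(ab+c)|² ≥ x·(x/A)/(log x)^{C'}` — a near-top right singular DIRECTION of the
  table can be taken completely multiplicative. Specific to `λ(·+c)`: the symbol-generic version is
  false (planted rank-one sign pattern on smooth rows × smooth columns; line card §Falsifier), so a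
  proof must use the multiplicativity / Hecke self-similarity `λ(pm) = −λ(m)` of the symbol, as the
  card itself anticipated. Under the crux it holds vacuously (`inverseCM_of_tableChowla`, PROVED;
  triage r1-3's point): it is a dichotomy lemma, informative only in the counterfactual branch.
* THE RESIDUAL `MeanSquareCM` (binary Elliott-type dispersion of `λ(ab+c)` against completely
  multiplicative column weights, in mean square over the dilations `a ∼ A`, every log-power saving):
  for every CM 1-bounded `g` and every `y ≤ x/A`, `∑_{a} |∑_{b ≤ y} g(b) λ(ab+c)|² ≤ x·(x/A)/(log x)^C`.
  PROVED to follow from the crux (`meanSquareCM_of_tableChowla`: `‖M g‖² ≤ ‖g‖²·√T`). It is cut by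
  proof technology into two registered stubs:
  - STUB `stub_periodic : MeanSquareCMPeriodic` — weights with a period `q ≤ (log x)^K` (constants,
    Dirichlet characters of polylogarithmic conductor: the ONE-POINT directions; the card's K2 in
    the exact form triage allowed): Bombieri–Vinogradov for `λ` with one residue and one height per
    modulus `aq ≤ 2x^{5/12}(log x)^K` = the route's support item `BVLiouville` (stmt-Parity-13324) at
    scale `3x`; Siegel–Walfisz is spent here and only here. Theorem-grade, size L.
  - STUB `stub_aperiodic : MeanSquareCMAperiodic` — all other CM weights (no period `≤ (log x)^K`, the
    prover choosing `K`): the TWO-POINT directions (`g = λ`: fixed-shift Chowla in the progressions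
    `0 mod a` in mean square over `a ∼ A`; `g = n^{it}`; characters of large conductor; generic CM
    `g`). Open-problem grade: the card's K3, widened to "binary Elliott with CM weights" as triage
    r1-2/r1-3 demanded.

LEAD RESHAPE r1 (line lead `prover-line-stmt-Parity-14270-0`, 2026-08-16): the theorem-grade stub
`stub_periodic` is split along its one unproved lean into `stub_bv : BVLiouville` (the route's support
item stmt-Parity-13324, by name) and `stub_periodic_of_bv : BVLiouville → MeanSquareCMPeriodic`
(bookkeeping, provable now), with `stub_periodic := stub_periodic_of_bv stub_bv` DERIVED; all four
registered stub signatures are inlined over Mathlib + route decls (Theorems-side files restate them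
textually). Registered stubs: `stub_inverse` (lead), `stub_bv`, `stub_periodic_of_bv`, `stub_aperiodic`.

Composition (kernel-checked, no `sorry` outside the registered stubs): `tableChowlaFor_of_stubs :
InverseCM → MeanSquareCMPeriodic → MeanSquareCMAperiodic → Negative.TableChowlaFor Negative.lam` (pure logic)
and THE SKELETON `TableChowla_of : TableChowla := …iff.mpr (tableChowlaFor_of_stubs stub_inverse stub_periodic
stub_aperiodic)` — the file's UNIQUE theorem concluding the crux decl by name (the hypothetical crux-named
form is the `example` next to it), via
`meanSquareCM_of_periodic_aperiodic` (excluded middle on "`g` has a period `q ≤ (log x)^K`"),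
`operatorNormForm_of_inverse_msed` (take `C'` from the inverse theorem, apply the residual at level
`C'+1`; for `log x > 1` the bounds are incompatible) and the proved transfer.

Disproof.lean obligations honoured (cdisprove gen-2 v10; checked against the LANDED
`Theorems/TableChowla/Negative/*`, which this file imports): `c ≠ 0`, `0 < δ`, `δ ≤ 1/12` and both
window ends are carried VERBATIM by every statement (cf. `not_tableChowlaWithoutShiftNeZero`,
`…WithoutDeltaPos`, `…WithoutDeltaLe`, `…WithoutLowerWindow`, `…WithoutUpperWindow`); all thresholds
are `∀ C ∃ x₀` (cf. `not_tableChowlaThresholdUniformInC`); no power saving and no polylog window is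
asserted (cf. `not_tableChowlaUniformPowerSaving`, `not_tableChowlaPolylogWindow`); the pretender
refutations (`not_tableChowlaFor_one`, `not_tableChowlaFor_chi4`, `momentN_of_rankOne`) are exactly
the rank-one PERIODIC directions that `stub_periodic` must beat for `λ` with Siegel–Walfisz — the
file's stated requirement that any proof use non-pretentiousness of `λ` to real characters of small
conductor. Since every stub is implied by the crux (exact splitting), no stub is an instance of a
refuted strengthening. Landed lemmas USED in the proofs below: `Negative.tableChowla_iff`,
`Negative.momentN_eq_colMoment`, `Negative.lam_sq_le_one`, `Negative.rows_mul_cols_le_window`,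
`Negative.eventually_log_rpow_le`.
-/

namespace Summit.Parity.GeneralizedHardyLittlewood.Cruxes.TableChowla.HelsonKroneckerInverse

open Summit.Parity.GeneralizedHardyLittlewood.Theses.LiouvilleShiftedTables

/-- The shifted multiplication table entry `λ(ab+c)` as a real number (the crux's summand; for
`a > |c|` the argument is positive, so `Int.toNat` never truncates inside the window). -/
noncomputable def entry (c : ℤ) (a b : ℕ) : ℝ :=
  (ArithmeticFunction.liouville (Int.toNat ((a : ℤ) * b + c)) : ℝ)

/-- TRANSFER TARGET `C⁺` (operator-norm form of the crux): for all `ℓ²`-unit test vectors `u` on the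
rows `(⌊A⌋,⌊2A⌋]` and `v` on the columns `[1,⌊x/A⌋]`, `|∑ u_a v_b λ(ab+c)| ≤ √x/(log x)^C`, every `C`,
uniformly in the window. Equivalent to `TableChowla` (`σ₁⁴ ≤ T ≤ σ₁²·‖M‖_F²`, `‖M‖_F² ≤ 2x`). -/
def OperatorNormForm : Prop :=
  ∀ c : ℤ, c ≠ 0 → ∀ δ : ℝ, 0 < δ → δ ≤ 1 / 12 → ∀ C : ℝ, 0 < C → ∃ x₀ : ℝ, ∀ x : ℝ, x₀ ≤ x →
    ∀ A : ℝ, x ^ δ ≤ A → A ≤ x ^ (1 / 3 + δ) →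
    ∀ u v : ℕ → ℝ, (∑ a ∈ Finset.Ioc ⌊A⌋₊ ⌊2 * A⌋₊, u a ^ 2 ≤ 1) →
      (∑ b ∈ Finset.Icc 1 ⌊x / A⌋₊, v b ^ 2 ≤ 1) →
      |∑ a ∈ Finset.Ioc ⌊A⌋₊ ⌊2 * A⌋₊, ∑ b ∈ Finset.Icc 1 ⌊x / A⌋₊, u a * v b * entry c a b| ≤
        x ^ (1 / 2 : ℝ) / Real.log x ^ C

/-- RESIDUAL (mean-square dispersion of the table against completely multiplicative column weights):
for every completely multiplicative `g : ℕ → ℂ` with `‖g‖ ≤ 1` and every initial segment `b ≤ y`,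
`y ≤ x/A`: `∑_{a ∈ (⌊A⌋,⌊2A⌋]} ‖∑_{b ≤ ⌊y⌋} g(b) λ(ab+c)‖² ≤ x·(x/A)/(log x)^C` (trivial bound `≍ x·(x/A)`;
random model `≍ x`). Binary Elliott for the pair `(g, λ)` on the forms `(b, ab+c)`, log-power saving, in
mean square over `≥ x^δ` dilations; implied by the crux; `g = 1, χ`: Bombieri–Vinogradov for `λ`
(theorem); `g = λ`: fixed-shift Chowla in the progressions `0 mod a` on average over `a ∼ A` (open). -/
def MeanSquareCM : Prop :=
  ∀ c : ℤ, c ≠ 0 → ∀ δ : ℝ, 0 < δ → δ ≤ 1 / 12 → ∀ C : ℝ, 0 < C → ∃ x₀ : ℝ, ∀ x : ℝ, x₀ ≤ x →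
    ∀ A : ℝ, x ^ δ ≤ A → A ≤ x ^ (1 / 3 + δ) →
    ∀ g : ℕ → ℂ, (∀ m n : ℕ, g (m * n) = g m * g n) → (∀ n : ℕ, ‖g n‖ ≤ 1) →
    ∀ y : ℝ, y ≤ x / A →
      ∑ a ∈ Finset.Ioc ⌊A⌋₊ ⌊2 * A⌋₊,
          ‖∑ b ∈ Finset.Icc 1 ⌊y⌋₊, g b * (entry c a b : ℂ)‖ ^ 2 ≤
        x * (x / A) / Real.log x ^ C

/-- RESIDUAL, ONE-POINT PART (registered stub): `MeanSquareCM` for the completely multiplicative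
1-bounded weights `g` that are `q`-PERIODIC for some `1 ≤ q ≤ (log x)^K` (constants and Dirichlet
characters of polylogarithmic conductor), for every `K`. Splitting `b` by classes mod `q` turns
`∑_{b ≤ y} g(b)λ(ab+c)` into `≤ q` sums of `λ` over progressions of modulus `aq ≤ 2x^{1/3+δ}(log x)^K
< x^{1/2-ε}`, so this is Bombieri–Vinogradov for `λ` with one (not necessarily coprime) residue and one
height per modulus — the route's support item `BVLiouville` (stmt-Parity-13324) at scale `3x`, with a
loss `q²·(multiplicity ≤ |c|q) = (log x)^{O(K)}`. Theorem-grade. -/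
def MeanSquareCMPeriodic : Prop :=
  ∀ c : ℤ, c ≠ 0 → ∀ δ : ℝ, 0 < δ → δ ≤ 1 / 12 → ∀ C : ℝ, 0 < C → ∀ K : ℝ, 0 < K → ∃ x₀ : ℝ,
    ∀ x : ℝ, x₀ ≤ x → ∀ A : ℝ, x ^ δ ≤ A → A ≤ x ^ (1 / 3 + δ) →
    ∀ g : ℕ → ℂ, (∀ m n : ℕ, g (m * n) = g m * g n) → (∀ n : ℕ, ‖g n‖ ≤ 1) →
    ∀ q : ℕ, 1 ≤ q → (q : ℝ) ≤ Real.log x ^ K → Function.Periodic g q →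
    ∀ y : ℝ, y ≤ x / A →
      ∑ a ∈ Finset.Ioc ⌊A⌋₊ ⌊2 * A⌋₊,
          ‖∑ b ∈ Finset.Icc 1 ⌊y⌋₊, g b * (entry c a b : ℂ)‖ ^ 2 ≤
        x * (x / A) / Real.log x ^ C

/-- RESIDUAL, TWO-POINT PART (registered stub): for some `K` of the prover's choosing (larger `K` =
fewer weights), `MeanSquareCM` for the completely multiplicative 1-bounded weights with NO period
`q ≤ (log x)^K`: `g = λ` (fixed-shift binary Chowla in the progressions `0 mod a`, mean square over
`a ∼ A`), `g = n^{it}`, characters of conductor `> (log x)^K`, `z^{Ω(n)}`, `𝟙_{smooth}`, generic CM `g`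
— binary Elliott for the pair `(g, λ)` with a log-power saving, averaged over `≥ x^δ` dilations of one
form. Open-problem grade (believed: random model `≍ x` against the bound `x·(x/A)/(log x)^C`). -/
def MeanSquareCMAperiodic : Prop :=
  ∀ c : ℤ, c ≠ 0 → ∀ δ : ℝ, 0 < δ → δ ≤ 1 / 12 → ∀ C : ℝ, 0 < C → ∃ K : ℝ, 0 < K ∧ ∃ x₀ : ℝ,
    ∀ x : ℝ, x₀ ≤ x → ∀ A : ℝ, x ^ δ ≤ A → A ≤ x ^ (1 / 3 + δ) →
    ∀ g : ℕ → ℂ, (∀ m n : ℕ, g (m * n) = g m * g n) → (∀ n : ℕ, ‖g n‖ ≤ 1) →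
    (∀ q : ℕ, 1 ≤ q → (q : ℝ) ≤ Real.log x ^ K → ¬ Function.Periodic g q) →
    ∀ y : ℝ, y ≤ x / A →
      ∑ a ∈ Finset.Ioc ⌊A⌋₊ ⌊2 * A⌋₊,
          ‖∑ b ∈ Finset.Icc 1 ⌊y⌋₊, g b * (entry c a b : ℂ)‖ ^ 2 ≤
        x * (x / A) / Real.log x ^ C

/-- THE LEVER (inverse theorem for finite Helson sections of `m ↦ λ(m+c)`, one-sided, `∀ C ∃ C'`):
a near-trivial value of the bilinear form on some pair of `ℓ²`-unit test vectors forces a completely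
multiplicative 1-bounded column weight `g` (on some initial segment `b ≤ y ≤ x/A`) whose image under
the table has near-trivial mean square over the rows. -/
def InverseCM : Prop :=
  ∀ c : ℤ, c ≠ 0 → ∀ δ : ℝ, 0 < δ → δ ≤ 1 / 12 → ∀ C : ℝ, 0 < C → ∃ C' : ℝ, 0 < C' ∧ ∃ x₀ : ℝ,
    ∀ x : ℝ, x₀ ≤ x → ∀ A : ℝ, x ^ δ ≤ A → A ≤ x ^ (1 / 3 + δ) →
    ∀ u v : ℕ → ℝ, (∑ a ∈ Finset.Ioc ⌊A⌋₊ ⌊2 * A⌋₊, u a ^ 2 ≤ 1) →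
      (∑ b ∈ Finset.Icc 1 ⌊x / A⌋₊, v b ^ 2 ≤ 1) →
      x ^ (1 / 2 : ℝ) / Real.log x ^ C ≤
        |∑ a ∈ Finset.Ioc ⌊A⌋₊ ⌊2 * A⌋₊, ∑ b ∈ Finset.Icc 1 ⌊x / A⌋₊, u a * v b * entry c a b| →
      ∃ g : ℕ → ℂ, (∀ m n : ℕ, g (m * n) = g m * g n) ∧ (∀ n : ℕ, ‖g n‖ ≤ 1) ∧
        ∃ y : ℝ, y ≤ x / A ∧
          x * (x / A) / Real.log x ^ C' ≤
            ∑ a ∈ Finset.Ioc ⌊A⌋₊ ⌊2 * A⌋₊,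
              ‖∑ b ∈ Finset.Icc 1 ⌊y⌋₊, g b * (entry c a b : ℂ)‖ ^ 2

/-! ## Registered stubs (LEAD RESHAPE r1, 2026-08-16: the `sorry`s live ONLY here; every stub
signature is INLINED over Mathlib + route decls, so that a Theorems-side `--supports stmt-Parity-14270`
file can state it textually without importing this work file; the named statements `InverseCM`,
`MeanSquareCMPeriodic`, `MeanSquareCMAperiodic` are recovered from the stubs definitionally below) -/

/-- **STUB `stub_inverse`** (the lever, size XL, conjectural — the line's new content; held by the lead):
inverse theorem for the finite Helson sections of `λ(·+c)` = `InverseCM` inlined. -/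
theorem stub_inverse :
    ∀ c : ℤ, c ≠ 0 → ∀ δ : ℝ, 0 < δ → δ ≤ 1 / 12 → ∀ C : ℝ, 0 < C → ∃ C' : ℝ, 0 < C' ∧ ∃ x₀ : ℝ,
    ∀ x : ℝ, x₀ ≤ x → ∀ A : ℝ, x ^ δ ≤ A → A ≤ x ^ (1 / 3 + δ) →
    ∀ u v : ℕ → ℝ, (∑ a ∈ Finset.Ioc ⌊A⌋₊ ⌊2 * A⌋₊, u a ^ 2 ≤ 1) →
      (∑ b ∈ Finset.Icc 1 ⌊x / A⌋₊, v b ^ 2 ≤ 1) →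
      x ^ (1 / 2 : ℝ) / Real.log x ^ C ≤
        |∑ a ∈ Finset.Ioc ⌊A⌋₊ ⌊2 * A⌋₊, ∑ b ∈ Finset.Icc 1 ⌊x / A⌋₊,
          u a * v b * (ArithmeticFunction.liouville (Int.toNat ((a : ℤ) * b + c)) : ℝ)| →
      ∃ g : ℕ → ℂ, (∀ m n : ℕ, g (m * n) = g m * g n) ∧ (∀ n : ℕ, ‖g n‖ ≤ 1) ∧
        ∃ y : ℝ, y ≤ x / A ∧
          x * (x / A) / Real.log x ^ C' ≤
            ∑ a ∈ Finset.Ioc ⌊A⌋₊ ⌊2 * A⌋₊,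
              ‖∑ b ∈ Finset.Icc 1 ⌊y⌋₊, g b *
                ((ArithmeticFunction.liouville (Int.toNat ((a : ℤ) * b + c)) : ℝ) : ℂ)‖ ^ 2 := by
  sorry

/-- **STUB `stub_bv`** (theorem-grade, size L–XL; = the route's support item `BVLiouville`,
stmt-Parity-13324, BY NAME — Bombieri–Vinogradov for `λ` at level `x^{1/2-ε}` with one arbitrary
residue and one height per modulus; all ingredients PROVED in tree: BFI Theorem 0(b)
`Literature.NumberTheory.Sieve.BombieriFriedlanderIwaniecTheorem0b_holds`, Siegel–Walfisz for `λ`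
`Literature.NumberTheory.LFunctions.SiegelWalfiszMoebius_holds` / `.liouville_progression`, Heath-Brown's
identity; print carrier vendored as the named fact
`Literature.NumberTheory.Sieve.FouvryTenenbaum2021_thm18_liouville`). When stmt-Parity-13324 is proved the
gate appends `BVLiouville_holds` to the route file and this stub closes by `exact BVLiouville_holds`. -/
theorem stub_bv :
    Summit.Parity.GeneralizedHardyLittlewood.Theses.LiouvilleShiftedTables.BVLiouville := by
  sorry

/-- **STUB `stub_periodic_of_bv`** (size L, PROVABLE NOW — bookkeeping, no new number theory): the
one-point residual `MeanSquareCMPeriodic` (inlined) from `BVLiouville`. Paper proof: split `b ≤ ⌊y⌋` by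
classes `r mod q`; `|∑_b g(b)λ(ab+c)| ≤ ∑_{r<q} |∑_{b ≡ r (q)} λ(ab+c)|` (`‖g‖ ≤ 1`, `g` constant on
classes); each inner sum is `λ` along ONE progression `n ≡ ar+c (mod aq)`, `n = (aq)·k + (ar+c)`,
`0 ≤ k ≤ (⌊y⌋-r)/q`, i.e. (after normalising the residue into `[0, aq)` and peeling `≤ 1` boundary
term) a sum `∑_{k=1}^{⌊y_d/d⌋} λ(d k + c_d)` with `d = aq ≤ 2x^{1/3+δ}(log x)^K ≤ x^{1/2-1/13}`
(eventually), `0 ≤ c_d < d`, height `y_d ≤ a y + a q ≤ 3x`; distinct `a` give distinct `d = aq`; so with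
`S_a := max_r |…|`: `∑_a |∑_b gλ|² ≤ ∑_a (q S_a)² ≤ q² · (max_a S_a) · ∑_a S_a ≤ q²(y/q + 2) · ∑_a S_a`
and `∑_a S_a ≤ (BV sum at scale 3x, ε = 1/13, exponent A' ) ≤ C'·3x/(log 3x)^{A'}`; with
`A' = C + 2K + 1` the total is `≤ x·(x/A)/(log x)^C` for `x ≥ x₀(c,δ,C,K)`. -/
theorem stub_periodic_of_bv :
    Summit.Parity.GeneralizedHardyLittlewood.Theses.LiouvilleShiftedTables.BVLiouville →
    ∀ c : ℤ, c ≠ 0 → ∀ δ : ℝ, 0 < δ → δ ≤ 1 / 12 → ∀ C : ℝ, 0 < C → ∀ K : ℝ, 0 < K → ∃ x₀ : ℝ,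
    ∀ x : ℝ, x₀ ≤ x → ∀ A : ℝ, x ^ δ ≤ A → A ≤ x ^ (1 / 3 + δ) →
    ∀ g : ℕ → ℂ, (∀ m n : ℕ, g (m * n) = g m * g n) → (∀ n : ℕ, ‖g n‖ ≤ 1) →
    ∀ q : ℕ, 1 ≤ q → (q : ℝ) ≤ Real.log x ^ K → Function.Periodic g q →
    ∀ y : ℝ, y ≤ x / A →
      ∑ a ∈ Finset.Ioc ⌊A⌋₊ ⌊2 * A⌋₊,
          ‖∑ b ∈ Finset.Icc 1 ⌊y⌋₊, g b *
            ((ArithmeticFunction.liouville (Int.toNat ((a : ℤ) * b + c)) : ℝ) : ℂ)‖ ^ 2 ≤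
        x * (x / A) / Real.log x ^ C := by
  sorry

/-- **STUB `stub_aperiodic`** (residual, two-point part; open-problem grade — binary Elliott for
`(g, λ)` with a log-power saving in mean square over dilations): aperiodic completely multiplicative
weights = `MeanSquareCMAperiodic` inlined. -/
theorem stub_aperiodic :
    ∀ c : ℤ, c ≠ 0 → ∀ δ : ℝ, 0 < δ → δ ≤ 1 / 12 → ∀ C : ℝ, 0 < C → ∃ K : ℝ, 0 < K ∧ ∃ x₀ : ℝ,
    ∀ x : ℝ, x₀ ≤ x → ∀ A : ℝ, x ^ δ ≤ A → A ≤ x ^ (1 / 3 + δ) →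
    ∀ g : ℕ → ℂ, (∀ m n : ℕ, g (m * n) = g m * g n) → (∀ n : ℕ, ‖g n‖ ≤ 1) →
    (∀ q : ℕ, 1 ≤ q → (q : ℝ) ≤ Real.log x ^ K → ¬ Function.Periodic g q) →
    ∀ y : ℝ, y ≤ x / A →
      ∑ a ∈ Finset.Ioc ⌊A⌋₊ ⌊2 * A⌋₊,
          ‖∑ b ∈ Finset.Icc 1 ⌊y⌋₊, g b *
            ((ArithmeticFunction.liouville (Int.toNat ((a : ℤ) * b + c)) : ℝ) : ℂ)‖ ^ 2 ≤
        x * (x / A) / Real.log x ^ C := by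
  sorry

/-! ## The named statements from the stubs (definitional; no `sorry` of their own) -/

/-- The lever statement `InverseCM` is literally `stub_inverse`. -/
theorem inverseCM_holds : InverseCM := stub_inverse

/-- The periodic residual, now DERIVED: `stub_periodic_of_bv` applied to `stub_bv`. -/
theorem stub_periodic : MeanSquareCMPeriodic := stub_periodic_of_bv stub_bv

/-- The aperiodic residual statement is literally `stub_aperiodic`. -/
theorem meanSquareCMAperiodic_holds : MeanSquareCMAperiodic := stub_aperiodic

/-! ## The transfer `OperatorNormForm → TableChowla` (real proof; was the card's stub
`tableChowla_of_operatorNormForm`, "provable now" — proved here, so it is NOT a registered stub) -/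

section Transfer

open Finset
open Summit.Parity.GeneralizedHardyLittlewood.Theorems.TableChowla

/-- Finite linear algebra `tr (M Mᵀ)² = ∑_a ‖M (Mᵀ e_a)‖² ≤ ‖M‖_op² · ‖M‖_F²`: an operator-norm
bound `K` for the bilinear form on `ℓ²`-unit test vectors bounds the fourth moment by `K²` times the
sum of the squared entries. -/
theorem moment_le_of_opNorm (e : ℕ → ℕ → ℝ) (R S : Finset ℕ) {K : ℝ}
    (hop : ∀ u v : ℕ → ℝ, ∑ a ∈ R, u a ^ 2 ≤ 1 → ∑ b ∈ S, v b ^ 2 ≤ 1 →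
      |∑ a ∈ R, ∑ b ∈ S, u a * v b * e a b| ≤ K) :
    ∑ a ∈ R, ∑ a' ∈ R, (∑ b ∈ S, e a b * e a' b) ^ 2 ≤ K ^ 2 * ∑ a ∈ R, ∑ b ∈ S, e a b ^ 2 := by
  rw [mul_sum]
  refine sum_le_sum fun a _ => ?_
  -- `I a' = (M w)_{a'}` for the column-weight vector `w = row a`; `N = ‖M w‖²`, `W = ‖w‖²`
  set I : ℕ → ℝ := fun a' => ∑ b ∈ S, e a b * e a' b with hI
  set N : ℝ := ∑ a' ∈ R, I a' ^ 2 with hN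
  set W : ℝ := ∑ b ∈ S, e a b ^ 2 with hW
  have hN0 : 0 ≤ N := sum_nonneg fun _ _ => sq_nonneg _
  have hW0 : 0 ≤ W := sum_nonneg fun _ _ => sq_nonneg _
  show N ≤ K ^ 2 * W
  by_cases hWz : W = 0
  · -- the row vanishes on `S`, hence so does `M w`
    have hw0 : ∀ b ∈ S, e a b = 0 := by
      intro b hb
      have hsq : e a b ^ 2 = 0 :=
        (sum_eq_zero_iff_of_nonneg (fun b _ => sq_nonneg (e a b))).mp hWz b hb
      exact pow_eq_zero_iff (two_ne_zero) |>.mp hsq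
    have hI0 : ∀ a' ∈ R, I a' = 0 := by
      intro a' _
      rw [hI]
      exact sum_eq_zero fun b hb => by rw [hw0 b hb, zero_mul]
    have hN' : N = 0 := sum_eq_zero fun a' ha' => by rw [hI0 a' ha']; ring
    rw [hN', hWz, mul_zero]
  by_cases hNz : N = 0
  · rw [hNz]; positivity
  have hWpos : 0 < W := lt_of_le_of_ne hW0 (Ne.symm hWz)
  have hNpos : 0 < N := lt_of_le_of_ne hN0 (Ne.symm hNz)
  have hsW : Real.sqrt W ^ 2 = W := Real.sq_sqrt hW0
  have hsN : Real.sqrt N ^ 2 = N := Real.sq_sqrt hN0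
  have hsWpos : 0 < Real.sqrt W := Real.sqrt_pos.mpr hWpos
  have hsNpos : 0 < Real.sqrt N := Real.sqrt_pos.mpr hNpos
  -- the unit test vectors `v = w/‖w‖`, `u = M w/‖M w‖`
  have hv1 : ∑ b ∈ S, (e a b / Real.sqrt W) ^ 2 ≤ 1 := by
    simp_rw [div_pow]
    rw [← sum_div, hsW, div_self hWz]
  have hu1 : ∑ a' ∈ R, (I a' / Real.sqrt N) ^ 2 ≤ 1 := by
    simp_rw [div_pow]
    rw [← sum_div, hsN, div_self hNz]
  have hIa : ∀ a', ∑ b ∈ S, e a b * e a' b = I a' := fun a' => by simp only [hI]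
  have hform : ∑ a' ∈ R, ∑ b ∈ S, (I a' / Real.sqrt N) * (e a b / Real.sqrt W) * e a' b =
      Real.sqrt N / Real.sqrt W := by
    have hstep : ∀ a', ∑ b ∈ S, (I a' / Real.sqrt N) * (e a b / Real.sqrt W) * e a' b =
        I a' ^ 2 / (Real.sqrt N * Real.sqrt W) := by
      intro a'
      calc ∑ b ∈ S, (I a' / Real.sqrt N) * (e a b / Real.sqrt W) * e a' b
          = (I a' / (Real.sqrt N * Real.sqrt W)) * ∑ b ∈ S, e a b * e a' b := by
            rw [mul_sum]
            refine sum_congr rfl fun b _ => ?_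
            ring
        _ = I a' ^ 2 / (Real.sqrt N * Real.sqrt W) := by rw [hIa]; ring
    simp_rw [hstep]
    rw [← sum_div, ← hN]
    have key : ∀ s : ℝ, 0 < s → s ^ 2 = N → N / (s * Real.sqrt W) = s / Real.sqrt W := by
      intro s hs hs2
      rw [← hs2, sq, mul_div_mul_left _ _ hs.ne']
    exact key _ hsNpos hsN
  have hb := hop (fun a' => I a' / Real.sqrt N) (fun b => e a b / Real.sqrt W) hu1 hv1
  rw [hform, abs_of_nonneg (div_nonneg hsNpos.le hsWpos.le), div_le_iff₀ hsWpos] at hb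
  calc N = Real.sqrt N ^ 2 := hsN.symm
    _ ≤ (K * Real.sqrt W) ^ 2 := pow_le_pow_left₀ hsNpos.le hb 2
    _ = K ^ 2 * W := by rw [mul_pow, hsW]

/-- THE TRANSFER (the card's `tableChowla_of_operatorNormForm`, proved; stated here with the landed
read-back form `Negative.TableChowlaFor Negative.lam`, which is the crux by `Negative.tableChowla_iff :
TableChowla ↔ TableChowlaFor lam := Iff.rfl`, so that `TableChowla_of` below is the file's FIRST
theorem concluding the crux decl by name; the crux-named form is `operatorNormForm_iff_tableChowla`
below). With `K = √x/(log x)^{C+1}`: `T ≤ K²·(rows·cols) ≤ 2x²/(log x)^{2C+2} ≤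
x²/(log x)^C` once `log x ≥ 2` (window bookkeeping `rows·cols ≤ 2x` and the eventuality are the landed
`Negative.rows_mul_cols_le_window`, `Negative.eventually_log_rpow_le`). -/
theorem tableChowlaFor_of_operatorNormForm (hop : OperatorNormForm) :
    Negative.TableChowlaFor Negative.lam := by
  intro c hc δ hδ hδ' C hC
  obtain ⟨x₁, h1⟩ := hop c hc δ hδ hδ' (C + 1) (by linarith)
  obtain ⟨X, hX⟩ := Negative.eventually_log_rpow_le hδ C
  refine ⟨max (max x₁ X) 1, ?_⟩
  intro x hx A hA hA'
  have hx₁ : x₁ ≤ x := le_trans (le_trans (le_max_left _ _) (le_max_left _ _)) hx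
  have hxX : X ≤ x := le_trans (le_trans (le_max_right _ _) (le_max_left _ _)) hx
  have hx1 : (1 : ℝ) ≤ x := le_trans (le_max_right _ _) hx
  have hx0 : (0 : ℝ) ≤ x := by linarith
  have hlog2 : 2 ≤ Real.log x := (hX x hxX).2
  have hL0 : 0 ≤ Real.log x := by linarith
  have hLpos : 0 < Real.log x := by linarith
  have hmom := moment_le_of_opNorm (entry c) (Ioc ⌊A⌋₊ ⌊2 * A⌋₊) (Icc 1 ⌊x / A⌋₊)
    (h1 x hx₁ A hA hA')
  -- `∑_{a,b} λ(ab+c)² ≤ rows·cols ≤ 2x`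
  have hE : ∑ a ∈ Ioc ⌊A⌋₊ ⌊2 * A⌋₊, ∑ b ∈ Icc 1 ⌊x / A⌋₊, entry c a b ^ 2 ≤ 2 * x := by
    calc ∑ a ∈ Ioc ⌊A⌋₊ ⌊2 * A⌋₊, ∑ b ∈ Icc 1 ⌊x / A⌋₊, entry c a b ^ 2
        ≤ ∑ _a ∈ Ioc ⌊A⌋₊ ⌊2 * A⌋₊, ∑ _b ∈ Icc 1 ⌊x / A⌋₊, (1 : ℝ) :=
          sum_le_sum fun a _ => sum_le_sum fun b _ => Negative.lam_sq_le_one _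
      _ = ((⌊2 * A⌋₊ - ⌊A⌋₊ : ℕ) : ℝ) * (⌊x / A⌋₊ : ℝ) := by
          simp only [sum_const, nsmul_eq_mul, mul_one, Nat.card_Ioc, Nat.card_Icc,
            Nat.add_sub_cancel]
      _ ≤ 2 * x := (Negative.rows_mul_cols_le_window hx1 hδ.le (by linarith) hA hA').1
  have hhalf : (x ^ (1 / 2 : ℝ)) ^ 2 = x := by
    rw [← Real.rpow_natCast, ← Real.rpow_mul hx0]
    norm_num
  have hLC1 : 1 ≤ Real.log x ^ C := Real.one_le_rpow (by linarith) hC.le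
  have hLC0 : 0 ≤ Real.log x ^ C := by linarith
  have hsucc : Real.log x ^ (C + 1) = Real.log x ^ C * Real.log x :=
    Real.rpow_add_one hLpos.ne' C
  show Negative.moment Negative.lam c x A ≤ x ^ 2 / Real.log x ^ C
  unfold Negative.moment Negative.momentN Negative.rowCorr
  calc _ ≤ (x ^ (1 / 2 : ℝ) / Real.log x ^ (C + 1)) ^ 2 *
          ∑ a ∈ Ioc ⌊A⌋₊ ⌊2 * A⌋₊, ∑ b ∈ Icc 1 ⌊x / A⌋₊, entry c a b ^ 2 := hmom
    _ ≤ (x ^ (1 / 2 : ℝ) / Real.log x ^ (C + 1)) ^ 2 * (2 * x) :=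
        mul_le_mul_of_nonneg_left hE (sq_nonneg _)
    _ = 2 * x ^ 2 / (Real.log x ^ C * Real.log x) ^ 2 := by
        rw [div_pow, hhalf, hsucc]
        ring
    _ ≤ x ^ 2 / Real.log x ^ C := by
        rw [div_le_div_iff₀ (by positivity) (by positivity)]
        -- `2 x² L^C ≤ x² (L^C L)²` since `L^C ≥ 1`, `L ≥ 2`
        have hx2 : 0 ≤ x ^ 2 * Real.log x ^ C := mul_nonneg (sq_nonneg _) hLC0
        have hL2 : 4 ≤ Real.log x ^ 2 := by nlinarith
        calc 2 * x ^ 2 * Real.log x ^ C ≤ x ^ 2 * Real.log x ^ C * (1 * 4) := by nlinarith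
          _ ≤ x ^ 2 * Real.log x ^ C * (Real.log x ^ C * Real.log x ^ 2) := by gcongr
          _ = x ^ 2 * (Real.log x ^ C * Real.log x) ^ 2 := by ring

end Transfer

/-! ## Composition (real proofs, no `sorry`) -/

/-- Excluded middle on "`g` has a period `q ≤ (log x)^K`" (with the `K` supplied by the aperiodic
half) reassembles the full residual. -/
theorem meanSquareCM_of_periodic_aperiodic (hP : MeanSquareCMPeriodic)
    (hA : MeanSquareCMAperiodic) : MeanSquareCM := by
  intro c hc δ hδ hδ' C hC
  obtain ⟨K, hK, x₂, h2⟩ := hA c hc δ hδ hδ' C hC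
  obtain ⟨x₁, h1⟩ := hP c hc δ hδ hδ' C hC K hK
  refine ⟨max x₁ x₂, ?_⟩
  intro x hx A hAlo hAhi g hgm hgb y hy
  have hx₁ : x₁ ≤ x := le_trans (le_max_left _ _) hx
  have hx₂ : x₂ ≤ x := le_trans (le_max_right _ _) hx
  by_cases hper : ∃ q : ℕ, 1 ≤ q ∧ (q : ℝ) ≤ Real.log x ^ K ∧ Function.Periodic g q
  · obtain ⟨q, hq1, hqK, hqp⟩ := hper
    exact h1 x hx₁ A hAlo hAhi g hgm hgb q hq1 hqK hqp y hy
  · exact h2 x hx₂ A hAlo hAhi g hgm hgb (fun q hq1 hqK hqp => hper ⟨q, hq1, hqK, hqp⟩) y hy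

/-- The dichotomy closes: the inverse theorem and the residual are incompatible with a near-extremal
pair of test vectors, so the operator-norm form holds. Pure logic plus `(log x)^{C'} < (log x)^{C'+1}`
for `x ≥ 3`. -/
theorem operatorNormForm_of_inverse_msed (hI : InverseCM) (hM : MeanSquareCM) :
    OperatorNormForm := by
  intro c hc δ hδ hδ' C hC
  obtain ⟨C', hC', x₁, h1⟩ := hI c hc δ hδ hδ' C hC
  obtain ⟨x₂, h2⟩ := hM c hc δ hδ hδ' (C' + 1) (by linarith)
  refine ⟨max (max x₁ x₂) 3, ?_⟩
  intro x hx A hA hA' u v hu hv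
  have hx₁ : x₁ ≤ x := le_trans (le_trans (le_max_left _ _) (le_max_left _ _)) hx
  have hx₂ : x₂ ≤ x := le_trans (le_trans (le_max_right _ _) (le_max_left _ _)) hx
  have hx3 : (3 : ℝ) ≤ x := le_trans (le_max_right _ _) hx
  by_contra hlt
  push Not at hlt
  obtain ⟨g, hgm, hgb, y, hy, hbig⟩ := h1 x hx₁ A hA hA' u v hu hv hlt.le
  have hsmall := h2 x hx₂ A hA hA' g hgm hgb y hy
  have hxpos : 0 < x := by linarith
  have hApos : 0 < A := lt_of_lt_of_le (Real.rpow_pos_of_pos hxpos δ) hA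
  have hnum : 0 < x * (x / A) := mul_pos hxpos (div_pos hxpos hApos)
  have hlog : 1 < Real.log x := by
    have he : Real.exp 1 < x :=
      lt_of_lt_of_le (lt_trans Real.exp_one_lt_d9 (by norm_num)) hx3
    exact (Real.lt_log_iff_exp_lt hxpos).2 he
  have hLpos : 0 < Real.log x := by linarith
  have hpow : Real.log x ^ C' < Real.log x ^ (C' + 1) :=
    Real.rpow_lt_rpow_of_exponent_lt hlog (by linarith)
  have hpowpos : 0 < Real.log x ^ C' := Real.rpow_pos_of_pos hLpos C'
  have hlt' : x * (x / A) / Real.log x ^ (C' + 1) < x * (x / A) / Real.log x ^ C' :=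
    div_lt_div_of_pos_left hnum hpowpos hpow
  linarith

/-- COMPOSITION in hypothetical (pure-logic) form: the three stub STATEMENTS imply the crux, stated on the
landed read-back form `Negative.TableChowlaFor Negative.lam` (= the crux by `Negative.tableChowla_iff`, an
`Iff.rfl`), so that `TableChowla_of` below is the file's UNIQUE theorem concluding the crux decl by name
(the skeleton audit takes the first such theorem and admits no untagged `Prop` hypotheses). -/
theorem tableChowlaFor_of_stubs :
    InverseCM → MeanSquareCMPeriodic → MeanSquareCMAperiodic →
      Summit.Parity.GeneralizedHardyLittlewood.Theorems.TableChowla.Negative.TableChowlaFor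
        Summit.Parity.GeneralizedHardyLittlewood.Theorems.TableChowla.Negative.lam :=
  fun hI hP hA =>
    tableChowlaFor_of_operatorNormForm
      (operatorNormForm_of_inverse_msed hI (meanSquareCM_of_periodic_aperiodic hP hA))

/-- THE SKELETON: the crux BY NAME from the three registered stubs (no `sorry` of its own — it is closed
exactly when `stub_inverse`, `stub_periodic`, `stub_aperiodic` are). -/
theorem TableChowla_of :
    Summit.Parity.GeneralizedHardyLittlewood.Theses.LiouvilleShiftedTables.TableChowla :=
  Summit.Parity.GeneralizedHardyLittlewood.Theorems.TableChowla.Negative.tableChowla_iff.mpr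
    (tableChowlaFor_of_stubs stub_inverse stub_periodic stub_aperiodic)

/-- The hypothetical form with the crux named (an `example`, so that no second theorem concludes the crux):
`stub_inverse`-statement → `stub_periodic`-statement → `stub_aperiodic`-statement → `TableChowla`. -/
example :
    InverseCM → MeanSquareCMPeriodic → MeanSquareCMAperiodic →
      Summit.Parity.GeneralizedHardyLittlewood.Theses.LiouvilleShiftedTables.TableChowla :=
  fun hI hP hA =>
    Summit.Parity.GeneralizedHardyLittlewood.Theorems.TableChowla.Negative.tableChowla_iff.mpr
      (tableChowlaFor_of_stubs hI hP hA)


/-! ## Honesty of the cut (real proofs): the crux implies the whole residual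

`TableChowla → MeanSquareCM` (hence `→ MeanSquareCMPeriodic ∧ MeanSquareCMAperiodic`): the residual
stubs are NOT stronger than the crux. Mechanism: `‖M g‖² = ∑_{b,b'} Re(g_b ḡ_{b'})·G(b,b')` with
`G = MᵀM`, one real Cauchy–Schwarz, and the column/row duality `∑ G² = tr(MMᵀ)²` landed in
`Theorems/TableChowla/Negative/TableChowlaTightness.lean` (`Negative.momentN_eq_colMoment`). -/

section Necessity

open Finset
open Summit.Parity.GeneralizedHardyLittlewood.Theorems.TableChowla

/-- Mean square against arbitrary complex column weights is controlled by the fourth moment: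
`∑_{a ∈ R} ‖∑_{b ∈ S} g_b e_{ab}‖² ≤ (∑_{b ∈ S} ‖g_b‖²) · √(∑_{b,b' ∈ S'} (∑_{a ∈ R} e_{ab} e_{ab'})²)`
for `S ⊆ S'` (`‖Mg‖² ≤ ‖g‖²·‖MᵀM‖_F`). -/
theorem meanSquare_le_norm_sq_mul_sqrt (c : ℤ) (R S S' : Finset ℕ) (hS : S ⊆ S') (g : ℕ → ℂ) :
    ∑ a ∈ R, ‖∑ b ∈ S, g b * (entry c a b : ℂ)‖ ^ 2 ≤
      (∑ b ∈ S, ‖g b‖ ^ 2) *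
        Real.sqrt (∑ b ∈ S', ∑ b' ∈ S', (∑ a ∈ R, entry c a b * entry c a b') ^ 2) := by
  -- the real Gram kernel of the columns and the real coefficient matrix of `g ⊗ ḡ`
  set G : ℕ → ℕ → ℝ := fun b b' => ∑ a ∈ R, entry c a b * entry c a b' with hG
  set h : ℕ → ℕ → ℝ := fun b b' => (g b * (starRingEnd ℂ) (g b')).re with hh
  -- Step 1: expansion `∑_a ‖v_a‖² = ∑_{b,b'} h(b,b') G(b,b')`
  have hsq : ∀ a : ℕ, ‖∑ b ∈ S, g b * (entry c a b : ℂ)‖ ^ 2 =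
      ∑ b ∈ S, ∑ b' ∈ S, h b b' * (entry c a b * entry c a b') := by
    intro a
    set v : ℂ := ∑ b ∈ S, g b * (entry c a b : ℂ) with hv
    have h1 : ‖v‖ ^ 2 = (v * (starRingEnd ℂ) v).re := by
      rw [Complex.mul_conj, Complex.ofReal_re, Complex.normSq_eq_norm_sq]
    have h2 : (starRingEnd ℂ) v = ∑ b' ∈ S, (starRingEnd ℂ) (g b') * (entry c a b' : ℂ) := by
      rw [hv, map_sum]
      refine sum_congr rfl fun b' _ => ?_
      rw [map_mul, Complex.conj_ofReal]
    rw [h1, h2, hv, sum_mul_sum, Complex.re_sum]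
    refine sum_congr rfl fun b _ => ?_
    rw [Complex.re_sum]
    refine sum_congr rfl fun b' _ => ?_
    have : g b * (entry c a b : ℂ) * ((starRingEnd ℂ) (g b') * (entry c a b' : ℂ)) =
        (g b * (starRingEnd ℂ) (g b')) * ((entry c a b * entry c a b' : ℝ) : ℂ) := by
      push_cast; ring
    rw [this, Complex.mul_re, Complex.ofReal_re, Complex.ofReal_im, mul_zero, sub_zero]
  have hexp : ∑ a ∈ R, ‖∑ b ∈ S, g b * (entry c a b : ℂ)‖ ^ 2 =
      ∑ b ∈ S, ∑ b' ∈ S, h b b' * G b b' := by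
    simp_rw [hsq]
    rw [sum_comm]
    refine sum_congr rfl fun b _ => ?_
    rw [sum_comm]
    refine sum_congr rfl fun b' _ => ?_
    rw [hG, mul_sum]
  -- Step 2: Cauchy–Schwarz over the pair index set `S ×ˢ S`
  have hpair : ∑ b ∈ S, ∑ b' ∈ S, h b b' * G b b' =
      ∑ p ∈ S ×ˢ S, h p.1 p.2 * G p.1 p.2 :=
    (sum_product' (s := S) (t := S) (f := fun b b' => h b b' * G b b')).symm
  have hCS : (∑ p ∈ S ×ˢ S, h p.1 p.2 * G p.1 p.2) ^ 2 ≤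
      (∑ p ∈ S ×ˢ S, h p.1 p.2 ^ 2) * ∑ p ∈ S ×ˢ S, G p.1 p.2 ^ 2 :=
    sum_mul_sq_le_sq_mul_sq _ _ _
  -- `h(b,b')² ≤ ‖g_b‖² ‖g_{b'}‖²`
  have hh2 : ∑ p ∈ S ×ˢ S, h p.1 p.2 ^ 2 ≤ (∑ b ∈ S, ‖g b‖ ^ 2) ^ 2 := by
    calc ∑ p ∈ S ×ˢ S, h p.1 p.2 ^ 2 ≤ ∑ p ∈ S ×ˢ S, ‖g p.1‖ ^ 2 * ‖g p.2‖ ^ 2 := by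
          refine sum_le_sum fun p _ => ?_
          rw [hh]
          dsimp only
          calc (g p.1 * (starRingEnd ℂ) (g p.2)).re ^ 2
              = (g p.1 * (starRingEnd ℂ) (g p.2)).re * (g p.1 * (starRingEnd ℂ) (g p.2)).re := sq _
            _ ≤ Complex.normSq (g p.1 * (starRingEnd ℂ) (g p.2)) := Complex.re_sq_le_normSq _
            _ = ‖g p.1‖ ^ 2 * ‖g p.2‖ ^ 2 := by
                rw [Complex.normSq_mul, Complex.normSq_conj, Complex.normSq_eq_norm_sq,
                  Complex.normSq_eq_norm_sq]
      _ = (∑ b ∈ S, ‖g b‖ ^ 2) ^ 2 := by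
          rw [sq (∑ b ∈ S, ‖g b‖ ^ 2), sum_mul_sum, ← sum_product']
  -- `∑_{S×S} G² ≤ ∑_{S'×S'} G²`
  have hGmono : ∑ p ∈ S ×ˢ S, G p.1 p.2 ^ 2 ≤
      ∑ b ∈ S', ∑ b' ∈ S', (∑ a ∈ R, entry c a b * entry c a b') ^ 2 := by
    rw [← sum_product' (f := fun b b' => (∑ a ∈ R, entry c a b * entry c a b') ^ 2)]
    refine sum_le_sum_of_subset_of_nonneg (product_subset_product hS hS) ?_
    intro p _ _
    positivity
  -- assemble
  have hg0 : 0 ≤ ∑ b ∈ S, ‖g b‖ ^ 2 := sum_nonneg fun b _ => by positivity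
  rw [hexp, hpair]
  calc ∑ p ∈ S ×ˢ S, h p.1 p.2 * G p.1 p.2
      ≤ |∑ p ∈ S ×ˢ S, h p.1 p.2 * G p.1 p.2| := le_abs_self _
    _ ≤ Real.sqrt ((∑ b ∈ S, ‖g b‖ ^ 2) ^ 2 *
          ∑ b ∈ S', ∑ b' ∈ S', (∑ a ∈ R, entry c a b * entry c a b') ^ 2) := by
        refine Real.abs_le_sqrt (le_trans hCS ?_)
        exact mul_le_mul hh2 hGmono (sum_nonneg fun p _ => by positivity) (by positivity)
    _ = (∑ b ∈ S, ‖g b‖ ^ 2) *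
          Real.sqrt (∑ b ∈ S', ∑ b' ∈ S', (∑ a ∈ R, entry c a b * entry c a b') ^ 2) := by
        rw [Real.sqrt_mul (sq_nonneg _), Real.sqrt_sq hg0]

/-- HONESTY: the crux implies the full residual `MeanSquareCM` (so neither residual stub is stronger
than the crux). From the crux at level `2C`: `‖M g‖² ≤ ‖g‖² √T ≤ (x/A) · x/(log x)^C`. -/
theorem meanSquareCM_of_tableChowla (hTC : TableChowla) : MeanSquareCM := by
  intro c hc δ hδ hδ' C hC
  have hTC' : Negative.TableChowlaFor Negative.lam := Negative.tableChowla_iff.mp hTC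
  obtain ⟨x₀, hx₀⟩ := hTC' c hc δ hδ hδ' (2 * C) (by linarith)
  refine ⟨max x₀ 1, ?_⟩
  intro x hx A hA hA' g hgm hgb y hy
  have hx₀' : x₀ ≤ x := le_trans (le_max_left _ _) hx
  have hx1 : (1 : ℝ) ≤ x := le_trans (le_max_right _ _) hx
  have hx0 : (0 : ℝ) ≤ x := by linarith
  have hxpos : (0 : ℝ) < x := by linarith
  have hApos : 0 < A := lt_of_lt_of_le (Real.rpow_pos_of_pos hxpos δ) hA
  have hL0 : 0 ≤ Real.log x := Real.log_nonneg hx1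
  -- the crux's moment in column form
  have hT : ∑ b ∈ Icc 1 ⌊x / A⌋₊, ∑ b' ∈ Icc 1 ⌊x / A⌋₊,
      (∑ a ∈ Ioc ⌊A⌋₊ ⌊2 * A⌋₊, entry c a b * entry c a b') ^ 2 ≤
        x ^ 2 / Real.log x ^ (2 * C) := by
    have hm := hx₀ x hx₀' A hA hA'
    unfold Negative.moment at hm
    rw [Negative.momentN_eq_colMoment] at hm
    exact hm
  -- columns `≤ ⌊y⌋` sit inside the crux's columns `≤ ⌊x/A⌋`
  have hsub : Icc 1 ⌊y⌋₊ ⊆ Icc 1 ⌊x / A⌋₊ := Icc_subset_Icc_right (Nat.floor_mono hy)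
  have hms := meanSquare_le_norm_sq_mul_sqrt c (Ioc ⌊A⌋₊ ⌊2 * A⌋₊) (Icc 1 ⌊y⌋₊)
    (Icc 1 ⌊x / A⌋₊) hsub g
  -- `‖g‖² ≤ ⌊y⌋ ≤ x/A`
  have hg2 : ∑ b ∈ Icc 1 ⌊y⌋₊, ‖g b‖ ^ 2 ≤ x / A := by
    calc ∑ b ∈ Icc 1 ⌊y⌋₊, ‖g b‖ ^ 2 ≤ ∑ _b ∈ Icc 1 ⌊y⌋₊, (1 : ℝ) :=
          sum_le_sum fun b _ => pow_le_one₀ (norm_nonneg _) (hgb b)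
      _ = (⌊y⌋₊ : ℝ) := by simp
      _ ≤ (⌊x / A⌋₊ : ℝ) := by exact_mod_cast Nat.floor_mono hy
      _ ≤ x / A := Nat.floor_le (div_nonneg hx0 hApos.le)
  -- `√T ≤ x/(log x)^C`
  have hsqrt : Real.sqrt (∑ b ∈ Icc 1 ⌊x / A⌋₊, ∑ b' ∈ Icc 1 ⌊x / A⌋₊,
      (∑ a ∈ Ioc ⌊A⌋₊ ⌊2 * A⌋₊, entry c a b * entry c a b') ^ 2) ≤ x / Real.log x ^ C := by
    have hpow : Real.log x ^ (2 * C) = (Real.log x ^ C) ^ 2 := by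
      rw [mul_comm, Real.rpow_mul hL0, Real.rpow_two]
    calc Real.sqrt _ ≤ Real.sqrt (x ^ 2 / Real.log x ^ (2 * C)) := Real.sqrt_le_sqrt hT
      _ = x / Real.log x ^ C := by
          rw [hpow, ← div_pow, Real.sqrt_sq (div_nonneg hx0 (Real.rpow_nonneg hL0 C))]
  calc ∑ a ∈ Ioc ⌊A⌋₊ ⌊2 * A⌋₊, ‖∑ b ∈ Icc 1 ⌊y⌋₊, g b * (entry c a b : ℂ)‖ ^ 2
      ≤ (∑ b ∈ Icc 1 ⌊y⌋₊, ‖g b‖ ^ 2) *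
          Real.sqrt (∑ b ∈ Icc 1 ⌊x / A⌋₊, ∑ b' ∈ Icc 1 ⌊x / A⌋₊,
            (∑ a ∈ Ioc ⌊A⌋₊ ⌊2 * A⌋₊, entry c a b * entry c a b') ^ 2) := hms
    _ ≤ (x / A) * (x / Real.log x ^ C) :=
        mul_le_mul hg2 hsqrt (Real.sqrt_nonneg _) (div_nonneg hx0 hApos.le)
    _ = x * (x / A) / Real.log x ^ C := by ring

/-- Consequently the crux implies both residual stubs' statements. -/
theorem meanSquareCMPeriodic_of_tableChowla (hTC : TableChowla) : MeanSquareCMPeriodic := by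
  intro c hc δ hδ hδ' C hC K hK
  obtain ⟨x₀, h⟩ := meanSquareCM_of_tableChowla hTC c hc δ hδ hδ' C hC
  exact ⟨x₀, fun x hx A hA hA' g hgm hgb q _ _ _ y hy => h x hx A hA hA' g hgm hgb y hy⟩

theorem meanSquareCMAperiodic_of_tableChowla (hTC : TableChowla) : MeanSquareCMAperiodic := by
  intro c hc δ hδ hδ' C hC
  obtain ⟨x₀, h⟩ := meanSquareCM_of_tableChowla hTC c hc δ hδ hδ' C hC
  exact ⟨1, one_pos, x₀, fun x hx A hA hA' g hgm hgb _ y hy => h x hx A hA hA' g hgm hgb y hy⟩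

end Necessity


/-! ## The converse calibrations (real proofs): the crux implies `C⁺` and (vacuously) the lever

`TableChowla → OperatorNormForm` (`(uᵀMv)⁴ ≤ ‖Mv‖⁴ ≤ T`, cf. triage r1-3's `bilinear_pow_four_le`)
and hence `TableChowla → InverseCM` (under the crux the hypothesis of the inverse theorem never fires:
triage r1-3's `inverseMH_of_tableChowla`, here for the one-sided `InverseCM`). Together with
`meanSquareCM_of_tableChowla` and `TableChowla_of`: the registered stub set is an EXACT splitting,
`TableChowla ↔ (InverseCM ∧ MeanSquareCMPeriodic ∧ MeanSquareCMAperiodic)` (`tableChowla_iff_stubs`). -/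

section Converse

open Finset
open Summit.Parity.GeneralizedHardyLittlewood.Theorems.TableChowla


/-- `C⁺` from the crux: `|uᵀ M v| ≤ ‖u‖·‖M v‖ ≤ T^{1/4} ≤ √x/(log x)^C` from the crux at level `4C`. -/
theorem operatorNormForm_of_tableChowla (hTC : TableChowla) : OperatorNormForm := by
  intro c hc δ hδ hδ' C hC
  have hTC' : Negative.TableChowlaFor Negative.lam := Negative.tableChowla_iff.mp hTC
  obtain ⟨x₀, hx₀⟩ := hTC' c hc δ hδ hδ' (4 * C) (by linarith)
  refine ⟨max x₀ 1, ?_⟩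
  intro x hx A hA hA' u v hu hv
  have hx₀' : x₀ ≤ x := le_trans (le_max_left _ _) hx
  have hx1 : (1 : ℝ) ≤ x := le_trans (le_max_right _ _) hx
  have hx0 : (0 : ℝ) ≤ x := by linarith
  have hL0 : 0 ≤ Real.log x := Real.log_nonneg hx1
  -- the crux's moment in column form
  have hT : ∑ b ∈ Icc 1 ⌊x / A⌋₊, ∑ b' ∈ Icc 1 ⌊x / A⌋₊,
      (∑ a ∈ Ioc ⌊A⌋₊ ⌊2 * A⌋₊, entry c a b * entry c a b') ^ 2 ≤
        x ^ 2 / Real.log x ^ (4 * C) := by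
    have hm := hx₀ x hx₀' A hA hA'
    unfold Negative.moment at hm
    rw [Negative.momentN_eq_colMoment] at hm
    exact hm
  -- `‖M v‖² ≤ ‖v‖² √T ≤ √T`
  set m : ℕ → ℝ := fun a => ∑ b ∈ Icc 1 ⌊x / A⌋₊, v b * entry c a b with hm_def
  have hms := meanSquare_le_norm_sq_mul_sqrt c (Ioc ⌊A⌋₊ ⌊2 * A⌋₊) (Icc 1 ⌊x / A⌋₊)
    (Icc 1 ⌊x / A⌋₊) (Subset.refl _) (fun b => (v b : ℂ))
  have hreal : ∀ a : ℕ, ‖∑ b ∈ Icc 1 ⌊x / A⌋₊, (v b : ℂ) * (entry c a b : ℂ)‖ ^ 2 = m a ^ 2 := by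
    intro a
    have : ∑ b ∈ Icc 1 ⌊x / A⌋₊, (v b : ℂ) * (entry c a b : ℂ) = ((m a : ℝ) : ℂ) := by
      rw [hm_def]
      push_cast
      rfl
    rw [this, Complex.norm_real, Real.norm_eq_abs, sq_abs]
  have hvnorm : ∑ b ∈ Icc 1 ⌊x / A⌋₊, ‖(v b : ℂ)‖ ^ 2 = ∑ b ∈ Icc 1 ⌊x / A⌋₊, v b ^ 2 := by
    refine sum_congr rfl fun b _ => ?_
    rw [Complex.norm_real, Real.norm_eq_abs, sq_abs]
  simp_rw [hreal] at hms
  rw [hvnorm] at hms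
  have hsqrtT0 : 0 ≤ Real.sqrt (∑ b ∈ Icc 1 ⌊x / A⌋₊, ∑ b' ∈ Icc 1 ⌊x / A⌋₊,
      (∑ a ∈ Ioc ⌊A⌋₊ ⌊2 * A⌋₊, entry c a b * entry c a b') ^ 2) := Real.sqrt_nonneg _
  have hMv : ∑ a ∈ Ioc ⌊A⌋₊ ⌊2 * A⌋₊, m a ^ 2 ≤ Real.sqrt (x ^ 2 / Real.log x ^ (4 * C)) :=
    calc ∑ a ∈ Ioc ⌊A⌋₊ ⌊2 * A⌋₊, m a ^ 2
        ≤ (∑ b ∈ Icc 1 ⌊x / A⌋₊, v b ^ 2) * Real.sqrt (∑ b ∈ Icc 1 ⌊x / A⌋₊,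
            ∑ b' ∈ Icc 1 ⌊x / A⌋₊, (∑ a ∈ Ioc ⌊A⌋₊ ⌊2 * A⌋₊, entry c a b * entry c a b') ^ 2) := hms
      _ ≤ 1 * Real.sqrt (∑ b ∈ Icc 1 ⌊x / A⌋₊,
            ∑ b' ∈ Icc 1 ⌊x / A⌋₊, (∑ a ∈ Ioc ⌊A⌋₊ ⌊2 * A⌋₊, entry c a b * entry c a b') ^ 2) :=
          mul_le_mul_of_nonneg_right hv hsqrtT0
      _ ≤ Real.sqrt (x ^ 2 / Real.log x ^ (4 * C)) := by
          rw [one_mul]; exact Real.sqrt_le_sqrt hT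
  -- `|uᵀ M v|² ≤ ‖u‖² ‖M v‖²`
  have hbil : ∑ a ∈ Ioc ⌊A⌋₊ ⌊2 * A⌋₊, ∑ b ∈ Icc 1 ⌊x / A⌋₊, u a * v b * entry c a b =
      ∑ a ∈ Ioc ⌊A⌋₊ ⌊2 * A⌋₊, u a * m a := by
    refine sum_congr rfl fun a _ => ?_
    rw [hm_def]
    dsimp only
    rw [mul_sum]
    refine sum_congr rfl fun b _ => ?_
    ring
  have hCS : (∑ a ∈ Ioc ⌊A⌋₊ ⌊2 * A⌋₊, u a * m a) ^ 2 ≤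
      (∑ a ∈ Ioc ⌊A⌋₊ ⌊2 * A⌋₊, u a ^ 2) * ∑ a ∈ Ioc ⌊A⌋₊ ⌊2 * A⌋₊, m a ^ 2 :=
    sum_mul_sq_le_sq_mul_sq _ _ _
  have hm0 : 0 ≤ ∑ a ∈ Ioc ⌊A⌋₊ ⌊2 * A⌋₊, m a ^ 2 := sum_nonneg fun _ _ => sq_nonneg _
  have hsq : (∑ a ∈ Ioc ⌊A⌋₊ ⌊2 * A⌋₊, u a * m a) ^ 2 ≤
      Real.sqrt (x ^ 2 / Real.log x ^ (4 * C)) :=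
    calc (∑ a ∈ Ioc ⌊A⌋₊ ⌊2 * A⌋₊, u a * m a) ^ 2
        ≤ (∑ a ∈ Ioc ⌊A⌋₊ ⌊2 * A⌋₊, u a ^ 2) * ∑ a ∈ Ioc ⌊A⌋₊ ⌊2 * A⌋₊, m a ^ 2 := hCS
      _ ≤ 1 * ∑ a ∈ Ioc ⌊A⌋₊ ⌊2 * A⌋₊, m a ^ 2 := mul_le_mul_of_nonneg_right hu hm0
      _ ≤ Real.sqrt (x ^ 2 / Real.log x ^ (4 * C)) := by rw [one_mul]; exact hMv
  -- numerics: `√(√(x²/L^{4C})) = √x/L^C`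
  have hLC0 : 0 ≤ Real.log x ^ C := Real.rpow_nonneg hL0 C
  have h4 : Real.log x ^ (4 * C) = ((Real.log x ^ C) ^ 2) ^ 2 := by
    rw [mul_comm, Real.rpow_mul hL0, show (4 : ℝ) = 2 * 2 by norm_num, Real.rpow_mul hLC0,
      Real.rpow_two, Real.rpow_two]
  have hroot : Real.sqrt (Real.sqrt (x ^ 2 / Real.log x ^ (4 * C))) =
      x ^ (1 / 2 : ℝ) / Real.log x ^ C := by
    rw [h4, ← div_pow, Real.sqrt_sq (div_nonneg hx0 (sq_nonneg _)), Real.sqrt_div' x (sq_nonneg _),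
      Real.sqrt_sq hLC0, Real.sqrt_eq_rpow]
  rw [hbil, ← hroot]
  exact Real.abs_le_sqrt hsq

/-- Under the crux the inverse theorem holds vacuously (its hypothesis never fires beyond `x₀`). -/
theorem inverseCM_of_operatorNormForm (hop : OperatorNormForm) : InverseCM := by
  intro c hc δ hδ hδ' C hC
  obtain ⟨x₁, h1⟩ := hop c hc δ hδ hδ' (C + 1) (by linarith)
  refine ⟨1, one_pos, max x₁ 3, ?_⟩
  intro x hx A hA hA' u v hu hv hbig
  exfalso
  have hx₁ : x₁ ≤ x := le_trans (le_max_left _ _) hx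
  have hx3 : (3 : ℝ) ≤ x := le_trans (le_max_right _ _) hx
  have hxpos : 0 < x := by linarith
  have hsmall := h1 x hx₁ A hA hA' u v hu hv
  have hlog : 1 < Real.log x := by
    have he : Real.exp 1 < x :=
      lt_of_lt_of_le (lt_trans Real.exp_one_lt_d9 (by norm_num)) hx3
    exact (Real.lt_log_iff_exp_lt hxpos).2 he
  have hLpos : 0 < Real.log x := by linarith
  have hpow : Real.log x ^ C < Real.log x ^ (C + 1) :=
    Real.rpow_lt_rpow_of_exponent_lt hlog (by linarith)
  have hnum : 0 < x ^ (1 / 2 : ℝ) := Real.rpow_pos_of_pos hxpos _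
  have hlt : x ^ (1 / 2 : ℝ) / Real.log x ^ (C + 1) < x ^ (1 / 2 : ℝ) / Real.log x ^ C :=
    div_lt_div_of_pos_left hnum (Real.rpow_pos_of_pos hLpos C) hpow
  linarith

theorem inverseCM_of_tableChowla (hTC : TableChowla) : InverseCM :=
  inverseCM_of_operatorNormForm (operatorNormForm_of_tableChowla hTC)

/-- EXACT SPLITTING: the crux is equivalent to the conjunction of the three registered stubs. -/
theorem tableChowla_iff_stubs :
    TableChowla ↔ (InverseCM ∧ MeanSquareCMPeriodic ∧ MeanSquareCMAperiodic) :=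
  ⟨fun h => ⟨inverseCM_of_tableChowla h, meanSquareCMPeriodic_of_tableChowla h,
      meanSquareCMAperiodic_of_tableChowla h⟩,
    fun h => Negative.tableChowla_iff.mpr (tableChowlaFor_of_stubs h.1 h.2.1 h.2.2)⟩

/-- … and `C⁺` is equivalent to the crux (the `→` direction is the card's transfer stub
`tableChowla_of_operatorNormForm`, proved as `tableChowlaFor_of_operatorNormForm`; stated as an `↔` so that no
second theorem concludes the crux decl by name). -/
theorem operatorNormForm_iff_tableChowla : OperatorNormForm ↔ TableChowla :=
  ⟨fun h => Negative.tableChowla_iff.mpr (tableChowlaFor_of_operatorNormForm h),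
    operatorNormForm_of_tableChowla⟩

end Converse

end Summit.Parity.GeneralizedHardyLittlewood.Cruxes.TableChowla.HelsonKroneckerInverse
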